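import Mathlib
import HarnessLib
import Summits.ResolutionOfSingularities.ResolutionOfSingularities.Theorems.WildQuotientsWildQuotientResolutionS1aA1Root

/-!
# S1a — INSTANCE I-2 (a1), MOVE 3 (THE KILL), ring level: (a′)₁, (H1) and the residual ideal on the model of the node of `[X₀]₂`

[OURS · L1 W4.5c · lead-1 g13; plan-1 CHAIN v10.40 §4 ASSIGNMENT (iii) «A1Move3Model … MT-a1″ move 3 (η₂:1, τ:1, e₁:2; δ1), one-row kills per
X-CERT v1 §3», R-F15c (I-2 := MT-a1″, move 3 on `[X₀′]₂`: centre `(s₂:1, Y₂:1, s:2)`), X-CERT v1 §3 a1 move 3 (all three charts KILLED, by the rows of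
`s₁ = X₁`, `x₄ = x₃`, `x₃′ = Y₂`)] — NOT statements of the manuscript; counted 0; AI-level work, weaker than expert review. Crux
stmt-ResolutionOfSingularities-17941 `CyclicQuotientFourfolds`, line `s1a-logminvertex` v13 (`stub_reachLowerInFX`). Pure commutative algebra.

The model of the node of the residual chart `W₂ = [X₀]₂` of move 2 is an ABSTRACT ring `Q` with elements `s₂` (torsor coordinate of move 2),
`Y₀ = X₀T₂²` (a unit there), `X₁` (a unit, carried from move 1), `Y₂ = x₂T₂`, `x₃`, `s` (torsor coordinate of move 1) and an automorphism `τ` with the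
ROWS (derived from move 2's `σ_R` by `sigmaR_algebraMap`/`sigmaR_mk`): `τX₁ = X₁ + s₂²Y₀s`, `τY₂ = Y₂ + s²Y₀s₂`, `τx₃ = x₃ + sX₁(s₂Y₂)`, `s₂, Y₀, s` and
a generating set `Gfix` fixed. Move 3 = centre `f₃ = (s₂, Y₂, s)`, weights `(1, 1, 2)`:
* `a1m3_admissible` — (a′)₁ relative to `β = s·s₂`: `y ∈ 𝒥ₙ ⇒ τ y − y ∈ (s s₂)·𝒥ₙ₊₁`; `a1m3_map_le`;
* ★ `a1m3_augmentationIdeal_sigmaR_le` — (H1) on `R₃ = R^w(Q; f₃; (1,1,2))`: `aug σ_R ≤ (g₃)`, `g₃ = (s s₂)·s₃` (`= s′·s₂′·s₃⁴` in X-CERT's bookkeeping);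
* ★ `a1m3_residual_mem` — the residual ideal `𝔞₃ = (aug σ_R : g₃)` contains `s₂′·Y₀` (row of `X₁`), `X₁·Y₂′` (row of `x₃`) and `Y₀·s′` (row of `Y₂′`)
  (`s₂′ = s₂T₃`, `Y₂′ = Y₂T₃`, `s′ = sT₃²`): with `Y₀`, `X₁` units each of the three producer charts `[s₂′], N(Y₂′), [s′]` contains a unit of `𝔞₃` — the
  one-row kills of X-CERT v1 §3 (cover and kill bookkeeping: `…S1aA1Move3Cover`).
-/

set_option linter.dupNamespace false

noncomputable section

open Literature.AlgebraicGeometry.Resolution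
open scoped LaurentPolynomial
open Summit.ResolutionOfSingularities.ResolutionOfSingularities.Theorems.WildQuotientResolution.S1.CoarseChart
open Summit.ResolutionOfSingularities.ResolutionOfSingularities.Theorems.WildQuotientResolution.S1.BlowupCharts

namespace Summit.ResolutionOfSingularities.ResolutionOfSingularities.Theorems.WildQuotientResolution.S1.KillCert.A1

variable {Q : Type} [CommRing Q] (τ : Q ≃+* Q) (s₂ Y₀ X₁ Y₂ x₃ s : Q) (Gfix : Set Q)
  (hs₂ : τ s₂ = s₂) (hY₀ : τ Y₀ = Y₀) (hX₁ : τ X₁ = X₁ + s₂ ^ 2 * Y₀ * s) (hY₂ : τ Y₂ = Y₂ + s ^ 2 * Y₀ * s₂)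
  (hx₃ : τ x₃ = x₃ + s * X₁ * (s₂ * Y₂)) (hs : τ s = s)
  (hfix : ∀ g ∈ Gfix, τ g = g) (hgen : Subring.closure (({s₂, Y₀, X₁, Y₂, x₃, s} : Set Q) ∪ Gfix) = ⊤)

/-! ## (a′)₁ relative to `β = s·s₂` -/

include hs₂ hY₀ hX₁ hY₂ hx₃ hs hfix hgen in
/-- **(a′)₁ for move 3 of MT-a1″**: `y ∈ 𝒥ₙ((s₂, Y₂, s), (1,1,2)) ⇒ τ y − y ∈ (s·s₂)·𝒥ₙ₊₁`. [OURS · L1 W4.5c · R-F15c move 3] -/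
theorem a1m3_admissible (n : ℕ) (y : Q) (hy : y ∈ (weightedFiltration (![s₂, Y₂, s] : Fin 3 → Q) ![1, 1, 2]).ideal n) :
    τ y - y ∈ Ideal.span {s * s₂} * (weightedFiltration (![s₂, Y₂, s] : Fin 3 → Q) ![1, 1, 2]).ideal (n + 1) := by
  have hJ0 : s₂ ∈ (weightedFiltration (![s₂, Y₂, s] : Fin 3 → Q) ![1, 1, 2]).ideal 1 := mem_weightedFiltration_ideal (![s₂, Y₂, s] : Fin 3 → Q) ![1, 1, 2] 0
  have hJ1 : Y₂ ∈ (weightedFiltration (![s₂, Y₂, s] : Fin 3 → Q) ![1, 1, 2]).ideal 1 := mem_weightedFiltration_ideal (![s₂, Y₂, s] : Fin 3 → Q) ![1, 1, 2] 1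
  have hJ2 : s ∈ (weightedFiltration (![s₂, Y₂, s] : Fin 3 → Q) ![1, 1, 2]).ideal 2 := mem_weightedFiltration_ideal (![s₂, Y₂, s] : Fin 3 → Q) ![1, 1, 2] 2
  have hJ2' : s ∈ (weightedFiltration (![s₂, Y₂, s] : Fin 3 → Q) ![1, 1, 2]).ideal 1 := (weightedFiltration _ _).antitone (by norm_num : 1 ≤ 2) hJ2
  have hβJ : ∀ {m : ℕ} {z : Q}, z ∈ (weightedFiltration (![s₂, Y₂, s] : Fin 3 → Q) ![1, 1, 2]).ideal m →
      s * s₂ * z ∈ Ideal.span {s * s₂} * (weightedFiltration (![s₂, Y₂, s] : Fin 3 → Q) ![1, 1, 2]).ideal m :=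
    fun hz => Ideal.mul_mem_mul (Ideal.mem_span_singleton_self (s * s₂)) hz
  have hzero : ∀ {m : ℕ} {z : Q}, τ z = z → τ z - z ∈ Ideal.span {s * s₂} * (weightedFiltration (![s₂, Y₂, s] : Fin 3 → Q) ![1, 1, 2]).ideal m :=
    fun h => by rw [h, sub_self]; exact Ideal.zero_mem _
  have m_X₁ : τ X₁ - X₁ ∈ Ideal.span {s * s₂} * (weightedFiltration (![s₂, Y₂, s] : Fin 3 → Q) ![1, 1, 2]).ideal 1 := by
    rw [hX₁, show X₁ + s₂ ^ 2 * Y₀ * s - X₁ = s * s₂ * (Y₀ * s₂) by ring]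
    exact hβJ (Ideal.mul_mem_left _ _ hJ0)
  have m_Y₂ : τ Y₂ - Y₂ ∈ Ideal.span {s * s₂} * (weightedFiltration (![s₂, Y₂, s] : Fin 3 → Q) ![1, 1, 2]).ideal (1 + 1) := by
    rw [hY₂, show Y₂ + s ^ 2 * Y₀ * s₂ - Y₂ = s * s₂ * (Y₀ * s) by ring]
    exact hβJ (Ideal.mul_mem_left _ _ hJ2)
  have m_x₃ : τ x₃ - x₃ ∈ Ideal.span {s * s₂} * (weightedFiltration (![s₂, Y₂, s] : Fin 3 → Q) ![1, 1, 2]).ideal 1 := by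
    rw [hx₃, show x₃ + s * X₁ * (s₂ * Y₂) - x₃ = s * s₂ * (X₁ * Y₂) by ring]
    exact hβJ (Ideal.mul_mem_left _ _ hJ1)
  refine admissible_of_generators (![s₂, Y₂, s] : Fin 3 → Q) ![1, 1, 2] τ (s * s₂) _ hgen ?_ ?_ n y hy
  · rintro g (hg | hg)
    · simp only [Set.mem_insert_iff, Set.mem_singleton_iff] at hg
      rcases hg with rfl | rfl | rfl | rfl | rfl | rfl
      · exact hzero hs₂
      · exact hzero hY₀
      · exact m_X₁
      · exact (Ideal.mul_mono_right ((weightedFiltration _ _).antitone (by norm_num : 1 ≤ 1 + 1))) m_Y₂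
      · exact m_x₃
      · exact hzero hs
    · exact hzero (hfix g hg)
  · intro i
    fin_cases i
    · exact hzero hs₂
    · exact m_Y₂
    · exact hzero hs

include hs₂ hY₀ hX₁ hY₂ hx₃ hs hfix hgen in
/-- **`τ`-stability** of the move-3 filtration. -/
theorem a1m3_map_le (n : ℕ) :
    ((weightedFiltration (![s₂, Y₂, s] : Fin 3 → Q) ![1, 1, 2]).ideal n).map (τ : Q →+* Q) ≤ (weightedFiltration (![s₂, Y₂, s] : Fin 3 → Q) ![1, 1, 2]).ideal n :=
  map_le_of_admissible (![s₂, Y₂, s] : Fin 3 → Q) ![1, 1, 2] τ (s * s₂) (a1m3_admissible τ s₂ Y₀ X₁ Y₂ x₃ s Gfix hs₂ hY₀ hX₁ hY₂ hx₃ hs hfix hgen) n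

/-! ## (H1) and the residual ideal -/

section Residual

variable {p : ℕ} (hp : 0 < p) (hσp : ∀ x : Q, (⇑τ)^[p] x = x)

include hs₂ hY₀ hX₁ hY₂ hx₃ hs hfix hgen in
/-- ★ **(H1) for move 3**: on `R₃ = R^w(Q; (s₂, Y₂, s); (1,1,2)) = Q[s₃, s₂T₃, Y₂T₃, sT₃²]`, `aug σ_R ≤ ((s s₂)·s₃)`. -/
theorem a1m3_augmentationIdeal_sigmaR_le :
    augmentationIdeal (sigmaR τ (![s₂, Y₂, s] : Fin 3 → Q) ![1, 1, 2] (a1m3_map_le τ s₂ Y₀ X₁ Y₂ x₃ s Gfix hs₂ hY₀ hX₁ hY₂ hx₃ hs hfix hgen) hp hσp) ≤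
      Ideal.span {algebraMap Q _ (s * s₂) * cobordantAlgebra.s (![s₂, Y₂, s] : Fin 3 → Q) ![1, 1, 2]} :=
  augmentationIdeal_sigmaR_le_span_of_admissible (![s₂, Y₂, s] : Fin 3 → Q) ![1, 1, 2] τ _ hp hσp (s * s₂)
    (a1m3_admissible τ s₂ Y₀ X₁ Y₂ x₃ s Gfix hs₂ hY₀ hX₁ hY₂ hx₃ hs hfix hgen)

include hX₁ in
/-- Row of `X₁`: `σ_R X₁ − X₁ = s₂²Y₀s = ((s s₂)·s₃)·(s₂′·Y₀)` (`s₂′ = s₂T₃`). -/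
theorem a1m3_sigmaR_X₁_sub
    (hσJ : ∀ n : ℕ, ((weightedFiltration (![s₂, Y₂, s] : Fin 3 → Q) ![1, 1, 2]).ideal n).map (τ : Q →+* Q) ≤
      (weightedFiltration (![s₂, Y₂, s] : Fin 3 → Q) ![1, 1, 2]).ideal n) :
    sigmaR τ (![s₂, Y₂, s] : Fin 3 → Q) ![1, 1, 2] hσJ hp hσp (algebraMap Q _ X₁) - algebraMap Q _ X₁ =
      (algebraMap Q _ (s * s₂) * cobordantAlgebra.s (![s₂, Y₂, s] : Fin 3 → Q) ![1, 1, 2]) *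
        (cobordantAlgebra.u' (![s₂, Y₂, s] : Fin 3 → Q) ![1, 1, 2] 0 * algebraMap Q _ Y₀) := by
  refine Subtype.ext ?_
  rw [AddSubgroupClass.coe_sub, MulMemClass.coe_mul, MulMemClass.coe_mul, MulMemClass.coe_mul, sigmaR_algebraMap, cobordantAlgebra.coe_algebraMap,
    cobordantAlgebra.coe_algebraMap, cobordantAlgebra.coe_algebraMap, cobordantAlgebra.coe_algebraMap, cobordantAlgebra.coe_s, cobordantAlgebra.coe_u']
  change LaurentPolynomial.C (τ X₁) - LaurentPolynomial.C X₁ =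
    LaurentPolynomial.C (s * s₂) * LaurentPolynomial.T (-1) * (LaurentPolynomial.C s₂ * LaurentPolynomial.T ((1 : ℕ) : ℤ) * LaurentPolynomial.C Y₀)
  rw [hX₁, map_add, map_mul, map_mul, map_mul, map_pow]
  have hT : LaurentPolynomial.T (-1) * LaurentPolynomial.T ((1 : ℕ) : ℤ) = (1 : Q[T;T⁻¹]) := by
    rw [← LaurentPolynomial.T_add]; norm_num
  calc LaurentPolynomial.C X₁ + LaurentPolynomial.C s₂ ^ 2 * LaurentPolynomial.C Y₀ * LaurentPolynomial.C s - LaurentPolynomial.C X₁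
      = LaurentPolynomial.C s₂ ^ 2 * LaurentPolynomial.C Y₀ * LaurentPolynomial.C s * (LaurentPolynomial.T (-1) * LaurentPolynomial.T ((1 : ℕ) : ℤ)) := by
        rw [hT]; ring
    _ = _ := by ring

include hx₃ in
/-- Row of `x₃`: `σ_R x₃ − x₃ = sX₁(s₂Y₂) = ((s s₂)·s₃)·(X₁·Y₂′)` (`Y₂′ = Y₂T₃`). -/
theorem a1m3_sigmaR_x₃_sub
    (hσJ : ∀ n : ℕ, ((weightedFiltration (![s₂, Y₂, s] : Fin 3 → Q) ![1, 1, 2]).ideal n).map (τ : Q →+* Q) ≤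
      (weightedFiltration (![s₂, Y₂, s] : Fin 3 → Q) ![1, 1, 2]).ideal n) :
    sigmaR τ (![s₂, Y₂, s] : Fin 3 → Q) ![1, 1, 2] hσJ hp hσp (algebraMap Q _ x₃) - algebraMap Q _ x₃ =
      (algebraMap Q _ (s * s₂) * cobordantAlgebra.s (![s₂, Y₂, s] : Fin 3 → Q) ![1, 1, 2]) *
        (algebraMap Q _ X₁ * cobordantAlgebra.u' (![s₂, Y₂, s] : Fin 3 → Q) ![1, 1, 2] 1) := by
  refine Subtype.ext ?_
  rw [AddSubgroupClass.coe_sub, MulMemClass.coe_mul, MulMemClass.coe_mul, MulMemClass.coe_mul, sigmaR_algebraMap, cobordantAlgebra.coe_algebraMap,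
    cobordantAlgebra.coe_algebraMap, cobordantAlgebra.coe_algebraMap, cobordantAlgebra.coe_algebraMap, cobordantAlgebra.coe_s, cobordantAlgebra.coe_u']
  change LaurentPolynomial.C (τ x₃) - LaurentPolynomial.C x₃ =
    LaurentPolynomial.C (s * s₂) * LaurentPolynomial.T (-1) * (LaurentPolynomial.C X₁ * (LaurentPolynomial.C Y₂ * LaurentPolynomial.T ((1 : ℕ) : ℤ)))
  rw [hx₃, map_add, map_mul, map_mul, map_mul, map_mul]
  have hT : LaurentPolynomial.T (-1) * LaurentPolynomial.T ((1 : ℕ) : ℤ) = (1 : Q[T;T⁻¹]) := by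
    rw [← LaurentPolynomial.T_add]; norm_num
  calc LaurentPolynomial.C x₃ + LaurentPolynomial.C s * LaurentPolynomial.C X₁ * (LaurentPolynomial.C s₂ * LaurentPolynomial.C Y₂) - LaurentPolynomial.C x₃
      = LaurentPolynomial.C s * LaurentPolynomial.C X₁ * (LaurentPolynomial.C s₂ * LaurentPolynomial.C Y₂) *
          (LaurentPolynomial.T (-1) * LaurentPolynomial.T ((1 : ℕ) : ℤ)) := by rw [hT]; ring
    _ = _ := by ring

include hY₂ in
/-- Row of `Y₂′ = Y₂T₃`: `σ_R Y₂′ − Y₂′ = (s²Y₀s₂)·T₃ = ((s s₂)·s₃)·(Y₀·s′)` (`s′ = sT₃²`). -/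
theorem a1m3_sigmaR_u'_one_sub
    (hσJ : ∀ n : ℕ, ((weightedFiltration (![s₂, Y₂, s] : Fin 3 → Q) ![1, 1, 2]).ideal n).map (τ : Q →+* Q) ≤
      (weightedFiltration (![s₂, Y₂, s] : Fin 3 → Q) ![1, 1, 2]).ideal n) :
    sigmaR τ (![s₂, Y₂, s] : Fin 3 → Q) ![1, 1, 2] hσJ hp hσp (cobordantAlgebra.u' (![s₂, Y₂, s] : Fin 3 → Q) ![1, 1, 2] 1) -
        cobordantAlgebra.u' (![s₂, Y₂, s] : Fin 3 → Q) ![1, 1, 2] 1 =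
      (algebraMap Q _ (s * s₂) * cobordantAlgebra.s (![s₂, Y₂, s] : Fin 3 → Q) ![1, 1, 2]) *
        (algebraMap Q _ Y₀ * cobordantAlgebra.u' (![s₂, Y₂, s] : Fin 3 → Q) ![1, 1, 2] 2) := by
  refine Subtype.ext ?_
  have hu1 : cobordantAlgebra.u' (![s₂, Y₂, s] : Fin 3 → Q) ![1, 1, 2] 1 =
      ⟨LaurentPolynomial.C Y₂ * LaurentPolynomial.T (((![1, 1, 2] : Fin 3 → ℕ) 1 : ℕ) : ℤ), (cobordantAlgebra.u' (![s₂, Y₂, s] : Fin 3 → Q) ![1, 1, 2] 1).2⟩ := rfl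
  rw [AddSubgroupClass.coe_sub, MulMemClass.coe_mul, MulMemClass.coe_mul, MulMemClass.coe_mul, cobordantAlgebra.coe_algebraMap, cobordantAlgebra.coe_s,
    cobordantAlgebra.coe_u', hu1, sigmaR_mk, cobordantAlgebra.coe_u', cobordantAlgebra.coe_algebraMap]
  change LaurentPolynomial.C (τ Y₂) * LaurentPolynomial.T ((1 : ℕ) : ℤ) - LaurentPolynomial.C Y₂ * LaurentPolynomial.T ((1 : ℕ) : ℤ) =
    LaurentPolynomial.C (s * s₂) * LaurentPolynomial.T (-1) * (LaurentPolynomial.C Y₀ * (LaurentPolynomial.C s * LaurentPolynomial.T ((2 : ℕ) : ℤ)))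
  rw [hY₂, map_add, map_mul, map_mul, map_mul, map_pow]
  have hT : LaurentPolynomial.T (-1) * LaurentPolynomial.T ((2 : ℕ) : ℤ) = (LaurentPolynomial.T ((1 : ℕ) : ℤ) : Q[T;T⁻¹]) := by
    rw [← LaurentPolynomial.T_add]; norm_num
  calc (LaurentPolynomial.C Y₂ + LaurentPolynomial.C s ^ 2 * LaurentPolynomial.C Y₀ * LaurentPolynomial.C s₂) * LaurentPolynomial.T ((1 : ℕ) : ℤ) -
        LaurentPolynomial.C Y₂ * LaurentPolynomial.T ((1 : ℕ) : ℤ)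
      = LaurentPolynomial.C s ^ 2 * LaurentPolynomial.C Y₀ * LaurentPolynomial.C s₂ * (LaurentPolynomial.T (-1) * LaurentPolynomial.T ((2 : ℕ) : ℤ)) := by
        rw [hT]; ring
    _ = _ := by ring

include hs₂ hY₀ hX₁ hY₂ hx₃ hs hfix hgen in
/-- ★ **`s₂′·Y₀ ∈ 𝔞₃`**, ★ **`X₁·Y₂′ ∈ 𝔞₃`**, ★ **`Y₀·s′ ∈ 𝔞₃`** — the residual ideal `𝔞₃ = (aug σ_R : (s s₂) s₃)` of move 3 contains the one-row
certificates of X-CERT v1 §3 (rows of `X₁`, `x₃`, `Y₂′`). -/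
theorem a1m3_residual_mem :
    cobordantAlgebra.u' (![s₂, Y₂, s] : Fin 3 → Q) ![1, 1, 2] 0 * algebraMap Q _ Y₀ ∈
        (augmentationIdeal (sigmaR τ (![s₂, Y₂, s] : Fin 3 → Q) ![1, 1, 2]
          (a1m3_map_le τ s₂ Y₀ X₁ Y₂ x₃ s Gfix hs₂ hY₀ hX₁ hY₂ hx₃ hs hfix hgen) hp hσp)).colon
          (Ideal.span {algebraMap Q _ (s * s₂) * cobordantAlgebra.s (![s₂, Y₂, s] : Fin 3 → Q) ![1, 1, 2]}) ∧
      algebraMap Q _ X₁ * cobordantAlgebra.u' (![s₂, Y₂, s] : Fin 3 → Q) ![1, 1, 2] 1 ∈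
        (augmentationIdeal (sigmaR τ (![s₂, Y₂, s] : Fin 3 → Q) ![1, 1, 2]
          (a1m3_map_le τ s₂ Y₀ X₁ Y₂ x₃ s Gfix hs₂ hY₀ hX₁ hY₂ hx₃ hs hfix hgen) hp hσp)).colon
          (Ideal.span {algebraMap Q _ (s * s₂) * cobordantAlgebra.s (![s₂, Y₂, s] : Fin 3 → Q) ![1, 1, 2]}) ∧
      algebraMap Q _ Y₀ * cobordantAlgebra.u' (![s₂, Y₂, s] : Fin 3 → Q) ![1, 1, 2] 2 ∈
        (augmentationIdeal (sigmaR τ (![s₂, Y₂, s] : Fin 3 → Q) ![1, 1, 2]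
          (a1m3_map_le τ s₂ Y₀ X₁ Y₂ x₃ s Gfix hs₂ hY₀ hX₁ hY₂ hx₃ hs hfix hgen) hp hσp)).colon
          (Ideal.span {algebraMap Q _ (s * s₂) * cobordantAlgebra.s (![s₂, Y₂, s] : Fin 3 → Q) ![1, 1, 2]}) := by
  refine ⟨?_, ?_, ?_⟩
  · rw [Ideal.mem_colon_span_singleton, mul_comm, ← a1m3_sigmaR_X₁_sub τ s₂ Y₀ X₁ Y₂ s hX₁ hp hσp]
    exact sub_mem_augmentationIdeal _ _
  · rw [Ideal.mem_colon_span_singleton, mul_comm, ← a1m3_sigmaR_x₃_sub τ s₂ X₁ Y₂ x₃ s hx₃ hp hσp]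
    exact sub_mem_augmentationIdeal _ _
  · rw [Ideal.mem_colon_span_singleton, mul_comm, ← a1m3_sigmaR_u'_one_sub τ s₂ Y₀ Y₂ s hY₂ hp hσp]
    exact sub_mem_augmentationIdeal _ _

end Residual

end Summit.ResolutionOfSingularities.ResolutionOfSingularities.Theorems.WildQuotientResolution.S1.KillCert.A1

end
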